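import Mathlib
import Literature.MathematicalPhysics.QuantumFieldTheory.Balaban1983to89.B7Prop6FirstClause
import Literature.MathematicalPhysics.QuantumFieldTheory.Balaban1983to89.B7Eq214
import Literature.MathematicalPhysics.QuantumFieldTheory.Balaban1983to89.DagBinding

/-!
# `Balaban1983to89.B7Carve48SectsDFHyp` — [Balaban1985Averaging] pp. 36–51 (Sects. D–F: PROPOSITION 3 p. 36 with the
# displays (121)–(126), the k-fold expansions (127)–(157) with PROPOSITIONS 4 (pp. 38–39) and 5 (p. 42), Sect. E
# analyticity (158)–(164) with PROPOSITIONS 6 and 7 (p. 43), Sect. F averaging for gauge transformations (165)–(214)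
# with PROPOSITIONS 8 (p. 45), 9 (p. 49), 10 (p. 50) and the closing linearization (207)–(214)):
# P6 CARVING-FAN BLOCK 48 — the block's residual printed sentences in hypothesis form and ONE hypothesis bundle `Hyp`
# of the pages' printed statements BY NAME, keyed to the consumer (`stmt-QuantumFields-20542`, K1⁷; DAG leaf `b7` of
# `DagBinding.Upstream.ofPrinted` = `B7.Concl …` = Props 1–10 of the paper, of which Props 3–10 are this block's)

statement-level skeleton of published theorems with citation tags; proofs where landed; nothing here is a claim about the
Yang–Mills mass gap

T. Bałaban, *Averaging operations for lattice gauge theories*, Commun. Math. Phys. **98** (1985) 17–51,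
doi:10.1007/bf01211042 `[Balaban1985Averaging]` (cell paper "B7"; journal page = PDF page + 16).  STATUS: published,
refereed.  PDF held: `paper:balaban1985-cmp98-averaging`; pp. 36–51 [PDF 20–35] read by this seat AS IMAGES (renders
`run/shared/lean/pub/pub-balaban/b2b-balaban-ref1/pages/1985-cmp98-averaging/1985-cmp98-averaging-p020-x2.png` …
`-p035-x2.png`, 2026-08-28) and on the text layer (`p0020.txt` … `p0035.txt`; line locators `pNNNN:Ln` below); p. 51
[PDF 35] is the reference list only.  [2] of the paper = `[Balaban1984PropagatorsI]` (B5).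

CITATION HEADER (lean-in-tree rule).  Cell `lit-balaban` (HOME `run/shared/lean/pub/lit-balaban/`), P6 CARVING FAN
(D-0154 (3b)), RESERVE block 48 of `carve/BLOCKS-41-48.md` (lead g31 RULING #10, `carve/STATUS.md` 08:16:31Z; claimed by
seat `carve-04` g6, CLAIM 08:20:57Z): «[B7] Sects. D–F pp. 36–51: properties of the averages, Props 3–10 pp.36–50,
analyticity, averaging for gauge transformations (121)–(214); 30 SKELETON rows (proved 20, proved-existing 10); KEY
stmt-QuantumFields-20542, also-feeds 20544».  RULES (`carve/CARVE-RULES.md` §2): IN TREE = CITE, NEVER RESTATE;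
residual printed statements in hypothesis form `def …Printed : Prop`; ONE bundle `Hyp`; no `instance`, no `notation`,
0 `sorry`.  Neighbour: block 47 (pp. 17–35, (1)–(120), Props 1–2); boundary = p. 35 last line ∕ p. 36 l. 1.

## WHAT THE BLOCK'S PAGES PRINT AND WHERE THE TREE HOLDS IT (cite table — all 30 SKELETON rows of the block are IN
## TREE, 20 of them PROVED on the concrete `ℤ^d` ∕ unit-lattice carriers of the `B7*` modules; nothing below is restated)
* p. 36 ll. 1–6 (`p0020:L1–L6`) standing clause «In all the estimates above, we have assumed that α₀, α₁ are sufficiently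
  small so that the formulas and inequalities proved in Sect. A hold, and that |Y_x| = O(L²α₀) are small. We restrict
  further α₁ … it is enough that it is ≤ ½. Under these assumptions it is obvious that functions of the variables A
  involved in all the formulas until now are analytic functions of A.» — the «α₀, α₁ ≤ c₃ ∕ c₄ ∕ c₅ …» thresholds of
  `B7.Prop3Printed` … `B7.Prop7Printed` (RULING #9 shape `∃ c > 0, ∀ α ≤ c`, already in the tree's typing); explicit in
  the PROVED model: `B7Prop3Flat.c3`, `B7Prop3Flat.prop3_flat_analyticOnNhd`.
* rows B7.Eq121, B7.Eq123, B7.Eq126, B7.Prop3 — (121)–(126) and PROPOSITION 3 p. 36 (`p0020:L36–L39`) «There exist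
  constants C₁, c₃, c₃ ≤ c₂, such that for α₀, α₁ ≤ c₃ the function Q(V₀, A) = (1/i) log V̿₁ is an analytic function of A
  satisfying the equalities and bounds (122)–(124). The constant C₁ depends on d and c₃ depends on d and L.»:
  `B7.Prop3Printed` (typed, verbatim), PROVED at the flat background with explicit constants realizing the dependency
  clause — `B7Prop3Flat.prop3_flat`, `C1` (= 1256(d+1)², a function of d alone), `c3` (= 1∕(128(d+1)L)),
  `prop3_flat_analyticOnNhd`; the linear form (124)∕(125) `B7Prop3GeneralLinear.Qcov`, (126)
  `B7Prop3GeneralLinearBound.norm_linQcov_le`; «C(V₀, A, c) is an analytic function of A whose Taylor's expansion begins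
  with a second-order polynomial» ⇐ (123): `B7Ineq148.hasFDerivAt_zero_of_sq_bound`, `eq_zero_of_sq_bound`; (123) at
  level one `B7Eq123LogCovIterLevelOne`.  Bundle member `Hyp.p3`.
* rows B7.Eq127, B7.Eq128 — (127)–(133) pp. 37–38 (the composition Q_j and the induction (130); «We assume that U₀
  satisfies the assumptions of Proposition 2 and U₁ = e^{iηA}, |A| < α₁. Then by this proposition the configurations
  U₀^j for j < k satisfy the assumptions of Proposition 3 …», «… ≤ 2α₁ for α₀, α₁ sufficiently small (O(1)α₀ ≤ ⅓, C₁α₁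
  ≤ ⅙)»): `B7Prop4GeneralLevels.logCovIter`, `B7Prop4Flat.prop4_flat_induction` (PROVED), `B7.ineq130_induction`,
  `ineq131_closure`, `ineq133_of_130` (kernel arithmetic), `B7Prop2Explicit` (Prop. 2 ⇒ the level-j regularity
  «α₀ + 2C₀α₀² < 2α₀», `B7.prop2_bound_lt_two_alpha`).
* row B7.Prop4 — PROPOSITION 4 pp. 38–39 (`p0022:L19–L25`, `p0023:L2–L3`) incl. «The constants C₂, c₄ are independent
  of k, C₂ depends on d and c₄ depends on d and L.»: `B7.Prop4Printed` (typed; k-independence = the constants are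
  chosen before the family index, which carries k; C₂ = e^{O(1)2α₀}8C₁ by `B7.ineq133_of_130`), PROVED on the model
  `B7Prop4Flat.prop4_flat`, general background `B7Prop4GeneralLevels`.  Bundle member `Hyp.p4`.
* (136) p. 39 decomposition into homogeneous polynomials — definitional; (137)–(138) the functional derivative and
  «From this definition it follows easily that the functional derivative coincides with partial derivatives (gradient)
  of F(A) multiplied by η^{−d}»: `B7Eq138FunctionalDerivative` (kernel theorems), `B7ConclKExp` (the density
  normalisation η^{−d}).
* rows B7.Eq137, B7.Eq139, B7.Eq148, B7.Eq149 — (137)–(155) pp. 39–41 («From (124) it is clear that we have the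
  inequalities (139) … The constant C′₁ depends on d and L» — genuine L-dependence, `B7.KExp` docstring ∕ cell G-adv4-6;
  (142)–(147); (148) «following easily from general properties of the function C(V₀, A). The constant C″₁ depends on d
  and L»; the induction (149)–(154); «This inequality is satisfied if C₃ > C″₁ and α₀, α₁ are sufficiently small, e.g.,
  we may take C₃ = 6C″₁ and …» (155)): `B7Prop5Flat.bump`, `B7BlockGeometry.Qav_Qav` (PROVED), `B7Ineq148.Ineq148Printed`
  (typed) with `ineq148Printed_of_123` (PROVED: (123) + analyticity ⇒ (148), C″₁ = 4C₁L^{d+2}), `B7Prop5Induction.Hyp154`,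
  `ineq143_succ`, `B7.ineq145_bracket`, `B7.ineq155_sample` (the sample constants of (155)).
* row B7.Prop5 — PROPOSITION 5 p. 42 (`p0026:L2–L7`): `B7.Prop5Printed` (typed, «sufficiently small» = threshold c₅ before
  the instance), PROVED on the model `B7Prop5Induction.ineq143_succ` ∕ `B7Prop5Flat` ∕ `B7Prop5General` ∕
  `B7ConclKExp`.  Bundle member `Hyp.p5`.
* rows B7.Eq158, B7.Eq159 — Sect. E lead-in p. 42 («We will prove that Ū^k is an analytic function of U on this domain
  … This neighborhood may be also described by the conditions |U − U₀| = |UU₀⁻¹ − 1| < α₁η, (158) α₁ is a sufficiently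
  small number.»), (159)–(163): `B7Eq92Concrete.vcov`, `avgIter_mul_eq_gaugeAct` (PROVED), `B7Prop6Bound` ((162)–(164)
  arithmetic), `B7Prop6GeneralAnalytic.vcovQ`.
* row B7.Prop6 — PROPOSITION 6 p. 43 (`p0027:L2–L6`) «If U₀ satisfies (52), then U′U₀‾^k is an analytic function of A′ …
  Moreover, we have a bound (164). Of course, we assume that α₀, α₁ are sufficiently small.»: `B7.Prop6Printed` (the (164)
  clause, the DAG's field) and `B7Prop6FirstClause.Prop6AnalyticPrinted` ∕ `Prop6PrintedFull` (first clause ∕ both clauses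
  under one threshold; `Prop6PrintedFull.toProp6Printed`, `prop6PrintedFull_iff`), PROVED on the model `B7Prop6Flat.prop6_flat`,
  `B7Prop6FirstClause.prop6PrintedFull_K`.  Bundle members `Hyp.p6` ((164) form, the DAG's) and `Hyp.p6full` (both
  clauses, on its `KExpA` family).
* row B7.Prop7 — p. 43 ll. 7–23 (`p0027:L7–L23`, the proof-by-modification: «Thus Proposition 3 holds uniformly for V′V₀
  instead of V₀ and with the only change in the inequality (126), where the constant e^{O(1)L²α₀} on the right-hand side
  is replaced by e^{O(1)(L²α₀+Lα₁)} … this change is easily incorporated») and PROPOSITION 7 (`p0027:L24–L26`):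
  `B7.Prop7Printed` (typed with the five-item modification list), `B7Prop7OneStep` («|Y_x| = O(L²α₀ + Lα₁)», (123)∕(126)
  uniformly in V′, PROVED), `B7Prop7LinearBound.norm_linQcov_le_general`, `B7Prop7Ins`; p. 43 ll. 27–28 «Similarly,
  Proposition 5 may be extended to include analyticity and uniformity statements. The formulations are obvious.»:
  `B7Prop5Cplx.prop5_cplx_156_uniform`, `B7Prop5CplxAnalytic.prop5_cplx_156_uniform_on_polydisc`, `B7Prop5CplxLevels`,
  `B7Prop5CplxOperator` (PROVED).  Bundle member `Hyp.p7`.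
* rows B7.Eq165, B7.Eq168 — (165)–(170) pp. 43–45 (the class Λ_k(U₀, α₃) (166)–(167); «From this it is obvious that for
  u ∈ Λ_k(U₀, α₃) and α₃ small, all operations needed to define R₀u^k are done always in a case where proper expressions
  are small»; (168)–(169); «Let us denote the constant in the above bound by C₃, so we have (170)»): `B7Eq167General.*`,
  `B7Eq167Flat.Cond166` ∕ `Cond167`, `B7Prop8to10Local.Cond166On` ∕ `Cond167On`, `B7Eq170Flat.eq170_flat` (PROVED).
* rows B7.Eq171, B7.Prop8 — (171)–(175) and PROPOSITION 8 p. 45 (`p0029:L18–L19`): `B7.Prop8Printed` (typed),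
  `B7.ineq173_recursion` (kernel), `B7Prop8Flat.eq173_flat`, `prop8_flat` (PROVED); the explicit smallness p. 45 l. 15
  «for α₃ sufficiently small, i.e., such that L⁻²(1 + C₃α₃)² ≤ ½» — RESIDUAL, §1 below (`Small173Printed`).  Bundle
  member `Hyp.p8`.
* rows B7.Eq176, B7.Eq180, B7.Eq181 — (176)–(198) pp. 45–49 ((176)–(177) regularity of u′; (178)–(179) the averages ũ′^j;
  p. 46 «We assume that the constants are sufficiently small, so that we can apply proper theorems and estimates»;
  (181)–(198) incl. p. 46 l. 17 «A constant in the bound above is an absolute constant»): `B7Prop9Flat.SiteBd`, `eq182`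
  (PROVED), `B7Ineq200General.eq200_printed`, `B7Prop9General.*`.
* row B7.Prop9 — PROPOSITION 9 p. 49 (`p0033:L5–L11`) incl. «In these bounds we have assumed that α′₄ = O(α₄), which will
  always be true here and in forthcoming papers»: `B7.Prop9Printed` (typed, the proviso as the ratio binder `α′₄ ≤ Mα₄`),
  `B7Prop9General`, `B7Prop10AsPrinted.prop9_printed_C4'` (PROVED).  Bundle member `Hyp.p9`.
* rows B7.Eq201, B7.Prop10 — (201)–(206) and PROPOSITION 10 pp. 49–50 («Let us denote β = α₀α₄ + α₃α₄ + α₄², C₅ =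
  1 + 4C′₅, C₄ = 8C′₄C₅»; «α₄L^jη + C₄β(L^jη)² ≤ … ≤ 2α₄ for α₀, α₃, α₄ sufficiently small, so the condition α′₄ =
  O(α₄) mentioned above is satisfied indeed»; «This result implies in particular that the configuration u′ belongs to the
  class Λ_k(C₅α₄)»): `B7.Prop10Printed` (typed), `B7.step205_alg`, `prop10_induction`, `ineq204_closed`, `tail204`
  (kernel), `B7Prop10Flat.rhs203`, `B7Prop10AsPrinted.rhs203_printed_le`, `ineq205_printed`, `prop10_as_printed`
  (C₄ = 8C′₄C₅ verbatim), `inLambda_C5_of_prop10` (the Λ_k(C₅α₄) sentence), `B7Prop10General` (PROVED).  Bundle member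
  `Hyp.p10`.
* rows B7.Eq207, B7.Eq209, B7.Eq212, B7.Eq213 — (207)–(214) p. 50 («The assumptions (176), (177) can be reformulated in
  terms of the functions λ … with a constant 4α₄ instead of α₄»; «It is obvious from the definition of the averaging
  operations that ũ′^j are analytic functions of λ, and (208) are analytic functions of λ also»; (209)–(214)):
  `B7Eq214.GaugeLinData`, `Eq207Printed`, `Eq214Printed` (typed), `ineq176_of_207`, `ineq177_of_207`, `sum_pow_mul_le`,
  `ineq214_of_212` (kernel), `B7Eq208Analytic`, `B7Eq212CollapsedGeneral`, `B7Eq78Linearization.QprimeIter`,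
  `B7Eq214FlatQprime` (PROVED).  Bundle members `Hyp.e207`, `Hyp.e214`.
* p. 51 [PDF 35]: references only.

## WHAT THIS FILE ADDS
§1 ONE RESIDUAL PRINTED SENTENCE with no declaration of record (searched 2026-08-28: `HOME/EXISTING-DECLS.tsv` rows of
`Balaban1985Averaging` with locators p. 36–50 ∕ (121)–(214), and `rg` over `Balaban1983to89/B7*.lean` for the prose
candidates of the block row — every other unnumbered sentence of pp. 36–50 resolves to a tree declaration, see the table):
`Small173Printed` — p. 45 l. 15 «for α₃ sufficiently small, i.e., such that L⁻²(1 + C₃α₃)² ≤ ½» (in the tree only as the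
binder `hq : q ≤ ½` of `B7.ineq173_recursion` and as the explicit smallness of `B7Prop8Flat`), with the kernel companion
`geomSum173_le_two` (the bracket of (173) is then ≤ 2, by `B7.geom_bracket_le_two`).
§2 THE BUNDLE.  `Carriers` — the families and constants the printed statements of pp. 36–50 are typed over in the tree
(exactly the Sect. D–F part of `B7.Concl`'s signature, plus the two extended families of `B7Prop6FirstClause` and
`B7Eq214`); `Hyp X` — PROPOSITIONS 3–10 and the typed closing statements (207), (208)+(213)–(214) AS HYPOTHESES, BY
NAME, in page order; consumer forms: `Hyp.concl` (with Props 1–2 of block 47 ⇒ `B7.Concl`, the conclusion record of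
the paper), `Hyp.dag_b7` (at the carriers of `DagBinding.PrintedCarriers` ⇒ the DAG's leaf
`(DagBinding.Upstream.ofPrinted X …).b7`), `Hyp.prop6_of_full` (Prop. 6's (164) clause on the extended family from the
full statement, `B7Prop6FirstClause.Prop6PrintedFull.toProp6Printed`).

## HONEST SCOPE
Nothing of [B7] is proved here beyond one line of real arithmetic and bookkeeping; Props 3–10 are NOT re-proved here
(hypothesis slots by name — their model-level PROOFS are the tree's `B7Prop3Flat` … `B7Prop10AsPrinted`, cited above);
the L-uniformity nuances of the printed dependency clauses («C₁ depends on d», «C₂ depends on d») are carried by the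
tree's family convention (constants before the instance, families for fixed d, L — `B7.KExp` docstring, cell DIVERGENCE
D-pv14.2) and realized by the explicit model constants (`B7Prop3Flat.C1 d`), not asserted anew.  No summit statement is
proved by this seat; count-neutral; nothing continuum ∕ ℝ⁴ ∕ OS ∕ mass-gap ∕ Clay.  No `sorry`, no `instance`, no
`notation`.
-/

namespace Literature.MathematicalPhysics.QuantumFieldTheory.Balaban1983to89.B7Carve48SectsDFHyp

/-! ## §1  The residual printed sentence of p. 45 (hypothesis form) with its kernel companion -/

/-- **p. 45, l. 15 [PDF 29]** (`p0029:L15`), verbatim (end of the induction (171)–(173)): «|r_j(x_j)| < C₃(α₃L^jη)²[1 +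
L⁻²(1 + C₃α₃)² + … + (L⁻²(1 + C₃α₃)²)^{j−1}] < 2C₃(α₃L^jη)² (173) for α₃ sufficiently small, i.e., such that
L⁻²(1 + C₃α₃)² ≤ ½.» — the explicit smallness behind PROPOSITION 8's «α₃ is sufficiently small, i.e., α₃ ≤ c₆ for some
c₆» (`B7.Prop8Printed`), on the reals `L` (block size), `C₃` (the constant of (170)) and `α₃`.  In the tree only as the
binder `hq : q ≤ 1/2` (q = L⁻²(1 + C₃α₃)²) of `B7.ineq173_recursion` and as the explicit numbers of `B7Prop8Flat`
(«0 ≤ α₃ ≤ 1∕3000, L ≥ 2»). [cite: Balaban1985Averaging, p.45 l.15 (after (173))] -/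
def Small173Printed (L C₃ α₃ : ℝ) : Prop := L⁻¹ ^ 2 * (1 + C₃ * α₃) ^ 2 ≤ 1 / 2

/-- Unfolding. [cite: Balaban1985Averaging, p.45 l.15 (after (173))] -/
theorem small173Printed_iff (L C₃ α₃ : ℝ) :
    Small173Printed L C₃ α₃ ↔ L⁻¹ ^ 2 * (1 + C₃ * α₃) ^ 2 ≤ 1 / 2 := Iff.rfl

/-- «… < 2C₃(α₃L^jη)²»: under the printed smallness the geometric bracket of (173), `1 + q + … + q^{j−1}` with
`q = L⁻²(1 + C₃α₃)²`, is at most 2 for every j (`B7.geom_bracket_le_two`; `q ≥ 0` automatically).  PROVED.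
[cite: Balaban1985Averaging, (173) p.45] -/
theorem geomSum173_le_two {L C₃ α₃ : ℝ} (h : Small173Printed L C₃ α₃) (j : ℕ) :
    ∑ i ∈ Finset.range j, (L⁻¹ ^ 2 * (1 + C₃ * α₃) ^ 2) ^ i ≤ 2 :=
  B7.geom_bracket_le_two _ (by positivity) h j

/-- Hence the printed last member of (173): `C₃(α₃L^jη)²·[bracket] ≤ 2C₃(α₃L^jη)²` (`C₃ ≥ 0`).  PROVED.
[cite: Balaban1985Averaging, (173) p.45] -/
theorem ineq173_last {L C₃ α₃ t : ℝ} (h : Small173Printed L C₃ α₃) (hC₃ : 0 ≤ C₃) (j : ℕ) :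
    C₃ * (α₃ * t) ^ 2 * ∑ i ∈ Finset.range j, (L⁻¹ ^ 2 * (1 + C₃ * α₃) ^ 2) ^ i ≤ 2 * C₃ * (α₃ * t) ^ 2 := by
  have hb := geomSum173_le_two h j
  have h0 : 0 ≤ C₃ * (α₃ * t) ^ 2 := by positivity
  nlinarith

/-! ## §2  The bundle: PROPOSITIONS 3–10 and the closing statements of p. 50 as hypotheses, by name -/

/-- **Carriers of the block-48 bundle**: the data over which the tree types the printed statements of pp. 36–50 —
exactly the Sect. D–F part of the signature of `B7.Concl` (the paper's conclusion record, = the DAG leaf `b7`): the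
block size `L` and the threshold `c₂` of Prop. 2 (Prop. 3's «c₃ ≤ c₂»), the one-step family `one` of Prop. 3
(`B7.OneStep`), the k-fold family `kexp` of Props 4–7 (`B7.KExp`), the gauge families `gd` of Props 8 and 10
(`B7.GaugeData`) and `gone` of Prop. 9 (`B7.GaugeOneStep`) — plus the two EXTENDED families of the later readers:
`kexpA` (`B7Prop6FirstClause.KExpA`, Prop. 6's first clause) and `glin` (`B7Eq214.GaugeLinData`, (207)–(214)).  Plain
data, no instances; index types for FIXED d and L (the tree's family convention). [cite: Balaban1985Averaging, Props. 3–10 pp.36–50] -/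
structure Carriers where
  I₁ : Type
  I₃ : Type
  I₄ : Type
  I₅ : Type
  I₆ : Type
  I₇ : Type
  L : ℝ
  c₂ : ℝ
  one : I₁ → B7.OneStep
  kexp : I₃ → B7.KExp
  gd : I₄ → B7.GaugeData
  gone : I₅ → B7.GaugeOneStep
  kexpA : I₆ → B7Prop6FirstClause.KExpA
  glin : I₇ → B7Eq214.GaugeLinData

/-- **BLOCK 48 BUNDLE — the printed statements of [Balaban1985Averaging] pp. 36–50 AS HYPOTHESES, BY NAME**, in page
order; one field per statement, each a reference to the declaration of record typing it (nothing restated; the verbatim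
quotations are in those declarations' docstrings): `p3` — PROPOSITION 3 p. 36 «There exist constants C₁, c₃, c₃ ≤ c₂,
such that for α₀, α₁ ≤ c₃ the function Q(V₀, A) = (1/i) log V̿₁ is an analytic function of A satisfying the equalities
and bounds (122)–(124)» (`B7.Prop3Printed`); `p4` — PROPOSITION 4 pp. 38–39, (134)–(135) (`B7.Prop4Printed`); `p5` —
PROPOSITION 5 p. 42, (156)–(157) (`B7.Prop5Printed`); `p6` — PROPOSITION 6 p. 43, the bound (164) (`B7.Prop6Printed`, the
DAG's field); `p6full` — PROPOSITION 6 p. 43, both clauses «U′U₀‾^k is an analytic function of A′ … Moreover (164)»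
(`B7Prop6FirstClause.Prop6PrintedFull`, on the extended family); `p7` — PROPOSITION 7 p. 43 «the function Q_k(U′U₀, ηA) is
analytic in complex variables A′, A, and Proposition 4 holds uniformly in A′» (`B7.Prop7Printed`); `p8` — PROPOSITION 8
p. 45 «If u₁, u₂ ∈ Λ_k(U₀, α₃) and α₃ is sufficiently small … then u = u₁u₂ ∈ Λ_k(U₀, 2α₃ + 2C₃α₃²) and we have (173)»
(`B7.Prop8Printed`); `p9` — PROPOSITION 9 p. 49, (199)–(200) (`B7.Prop9Printed`); `p10` — PROPOSITION 10 p. 50, (203)–(204)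
for j ≤ k (`B7.Prop10Printed`); `e207` — p. 50 «If we assume (207), α₄ sufficiently small, then assumptions (176), (177)
are satisfied with a constant 4α₄ instead of α₄» (`B7Eq214.Eq207Printed`); `e214` — p. 50 «ũ′^j are analytic functions of
λ, and Q′_j(u₁, λ) = (1/i) log ũ′^j, j ≤ k, (208) are analytic functions of λ also … (213), (214)» (`B7Eq214.Eq214Printed`).
Hypothesis slot only. [cite: Balaban1985Averaging, Prop. 3 p.36, Prop. 4 pp.38–39, Prop. 5 p.42, Props. 6–7 p.43, Prop. 8 p.45, Prop. 9 p.49, Prop. 10 p.50, (207)–(214) p.50] -/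
structure Hyp (X : Carriers) : Prop where
  p3 : B7.Prop3Printed X.L X.c₂ X.one
  p4 : B7.Prop4Printed X.kexp
  p5 : B7.Prop5Printed X.kexp
  p6 : B7.Prop6Printed X.kexp
  p6full : B7Prop6FirstClause.Prop6PrintedFull X.kexpA
  p7 : B7.Prop7Printed X.kexp
  p8 : B7.Prop8Printed X.gd
  p9 : B7.Prop9Printed X.L X.gone
  p10 : B7.Prop10Printed X.gd
  e207 : B7Eq214.Eq207Printed X.glin
  e214 : B7Eq214.Eq214Printed X.glin

variable {X : Carriers}

/-- **The paper's conclusion record**: the bundle (Props 3–10, this block) together with PROPOSITIONS 1 and 2 (pp. 26–27,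
block 47's pages) over a k-step family `kst` with Prop. 2's constants `C₀, c₂′` IS `B7.Concl` — the conclusion atom the
DAG consumes (`DagBinding.Upstream.ofPrinted … .b7`).  Bookkeeping. [cite: Balaban1985Averaging, Props. 1–10 pp.26–50] -/
theorem Hyp.concl (h : Hyp X) {I₂ : Type} {C₀ c₂' : ℝ} (kst : I₂ → B7.KStep) (h1 : B7.Prop1Printed X.L X.one)
    (h2 : B7.Prop2Printed C₀ c₂' kst) : B7.Concl X.L X.c₂ C₀ c₂' X.one kst X.kexp X.gd X.gone :=
  ⟨h1, h2, h.p3, h.p4, h.p5, h.p6, h.p7, h.p8, h.p9, h.p10⟩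

/-- Conversely the Sect. D–F members of any `B7.Concl` are the bundle's Props 3–10 (the two extended-family members
`p6full`, `e207`, `e214` are not fields of `B7.Concl`).  Bookkeeping. [cite: Balaban1985Averaging, Props. 3–10 pp.36–50] -/
theorem props3to10_of_concl {I₂ : Type} {C₀ c₂' : ℝ} {kst : I₂ → B7.KStep}
    (hc : B7.Concl X.L X.c₂ C₀ c₂' X.one kst X.kexp X.gd X.gone) :
    B7.Prop3Printed X.L X.c₂ X.one ∧ B7.Prop4Printed X.kexp ∧ B7.Prop5Printed X.kexp ∧ B7.Prop6Printed X.kexp ∧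
      B7.Prop7Printed X.kexp ∧ B7.Prop8Printed X.gd ∧ B7.Prop9Printed X.L X.gone ∧ B7.Prop10Printed X.gd :=
  ⟨hc.p3, hc.p4, hc.p5, hc.p6, hc.p7, hc.p8, hc.p9, hc.p10⟩

/-- The carriers of this block read off the DAG's record `DagBinding.PrintedCarriers` (its B7 group of fields), extended
by the two later-reader families. [cite: Balaban1985Averaging, Props. 3–10 pp.36–50] -/
def Carriers.ofDag (Xc : DagBinding.PrintedCarriers) {I₆ I₇ : Type} (kexpA : I₆ → B7Prop6FirstClause.KExpA)
    (glin : I₇ → B7Eq214.GaugeLinData) : Carriers where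
  I₁ := Xc.I7a
  I₃ := Xc.I7c
  I₄ := Xc.I7d
  I₅ := Xc.I7e
  I₆ := I₆
  I₇ := I₇
  L := Xc.L7
  c₂ := Xc.c₂
  one := Xc.one7
  kexp := Xc.kexp7
  gd := Xc.gd7
  gone := Xc.gone7
  kexpA := kexpA
  glin := glin

/-- **The DAG's `b7` leaf**: at the carriers of `DagBinding.PrintedCarriers`, the bundle together with PROPOSITIONS 1–2
(block 47) IS the upstream leaf `b7 = B7.Concl X.L7 X.c₂ X.C₀ X.c₂' X.one7 X.kst7 X.kexp7 X.gd7 X.gone7` of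
`DagBinding.Upstream.ofPrinted` (node [B7] of the K⁷ consumer).  Bookkeeping. [cite: Balaban1985Averaging, Props. 1–10 pp.26–50] -/
theorem Hyp.dag_b7 {Xc : DagBinding.PrintedCarriers} {I₆ I₇ : Type} {kexpA : I₆ → B7Prop6FirstClause.KExpA}
    {glin : I₇ → B7Eq214.GaugeLinData} (h : Hyp (Carriers.ofDag Xc kexpA glin))
    (h1 : B7.Prop1Printed Xc.L7 Xc.one7) (h2 : B7.Prop2Printed Xc.C₀ Xc.c₂' Xc.kst7) (b9 b11 rOp rBS : Prop) :
    (DagBinding.Upstream.ofPrinted Xc b9 b11 rOp rBS).b7 :=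
  (show B7.Concl Xc.L7 Xc.c₂ Xc.C₀ Xc.c₂' Xc.one7 Xc.kst7 Xc.kexp7 Xc.gd7 Xc.gone7 from h.concl Xc.kst7 h1 h2)

/-- PROPOSITION 6's (164) clause on the extended family, from the full statement (`p6full`), by the tree's
`B7Prop6FirstClause.Prop6PrintedFull.toProp6Printed`. [cite: Balaban1985Averaging, Prop. 6 (164) p.43] -/
theorem Hyp.prop6_of_full (h : Hyp X) : B7.Prop6Printed (fun i => (X.kexpA i).toKExp) :=
  h.p6full.toProp6Printed

/-- PROPOSITION 6's first clause (analyticity of U′U₀‾^k in A′) on the extended family, from `p6full`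
(`B7Prop6FirstClause.prop6PrintedFull_iff`). [cite: Balaban1985Averaging, Prop. 6 p.43] -/
theorem Hyp.prop6_analytic (h : Hyp X) : B7Prop6FirstClause.Prop6AnalyticPrinted X.kexpA :=
  ((B7Prop6FirstClause.prop6PrintedFull_iff X.kexpA).mp h.p6full).1

end Literature.MathematicalPhysics.QuantumFieldTheory.Balaban1983to89.B7Carve48SectsDFHyp
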